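import Mathlib
import HarnessLib
import Literature.Analysis.Calculus.TVSDerivSlope

/-!
# Derivatives of curves in a topological vector space, II: congruence, the chain rule, and the
# Leibniz rule along a jointly continuous family of linear maps

Topic `Analysis/Calculus`; namespace `Literature.Analysis.Calculus.TVSDeriv` (continuing
`TVSDerivSlope.lean`). `F`, `G` are topological vector spaces over a nontrivially normed field `𝕜`
(`[IsTopologicalAddGroup F] [ContinuousSMul 𝕜 F]`); Mathlib proves the statements below only for a normed
codomain (`Mathlib.Analysis.Calculus.Deriv.Comp`, `.Add`, `.Mul`), all new names carry the suffix `_tvs`.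

* §1 local nature and algebra: `HasDerivAt.congr_of_eventuallyEq_tvs` (from Mathlib's TVS-general
  `HasFDerivAt.congr_of_eventuallyEq`), `hasDerivAt_const_tvs`, `HasDerivAt.neg_tvs`, `.sub_tvs`, `.sum_tvs`
  (Bourbaki FVR I §1 n°2 Prop. 1 [cite: Bourbaki1949FVR, I §1 no.2 Prop. 1]), and scalar functions times a
  fixed vector `HasDerivAt.smul_const_tvs` (scalars in a normed algebra `𝕜'` over `𝕜`, e.g. `ℂ`-valued
  coefficients of a real parameter);
* §2 the **chain rule** `HasDerivAt.scomp_tvs`: `f` with derivative `f'` at `u x`, `u : 𝕜 → 𝕜` with derivative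
  `u'` at `x` ⇒ `f ∘ u` has derivative `u' • f'` at `x` — Bourbaki FVR I §1 n°5 **Proposition 5** (held text
  p0018) [cite: Bourbaki1949FVR, I §1 no.5 Prop. 5], proved through the Carathéodory form
  `HasDerivAt.exists_slope_fun_tvs` (`f y - f y₀ = (y - y₀) • ψ y`, `ψ` continuous at `y₀`, `ψ y₀ = f'`); affine
  reparametrisations `comp_const_add_tvs`, `comp_add_const_tvs`, `comp_const_mul_tvs`;
* §3 the **Leibniz rule along a jointly continuous family of linear maps** `HasDerivAt.linearFamily_tvs`: for
  `A : X → (F →ₗ[𝕜] G)` with `(p, v) ↦ A p v` jointly continuous, `g : 𝕜 → X` continuous at `x`, `f` with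
  derivative `f'` at `x` and `t ↦ A (g t) (f x)` (fixed vector) with derivative `δ` at `x`, the curve
  `t ↦ A (g t) (f t)` has derivative `A (g x) f' + δ` at `x` (the proof of Bourbaki's Prop. 3, joint
  continuity replacing bilinearity) [folklore]; specialised to a representation `π : G →* Module.End 𝕜 F` of a
  topological monoid/group by jointly continuous linear maps: products of one-parameter families
  `hasDerivAt_repr_mul_tvs`, generator additivity at the identity `hasDerivAt_repr_mul_of_eq_one_tvs`
  (`d/dt|ₓ π(e₁(t) e₂(t)) v = X₁ + X₂`, no Baker–Campbell–Hausdorff), conjugate families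
  `hasDerivAt_repr_conj_tvs` (`d/dt π(w e(t) w⁻¹) v = π(w) X`) [folklore];
* §4 curves through a finite-dimensional space: `HasDerivAt.linearMap_comp_of_finiteDimensional_tvs` (any
  linear `ι : V →ₗ[𝕜] F` from a finite-dimensional Hausdorff `V`, complete `𝕜`, transports derivatives — it is
  automatically continuous) and `hasDerivAt_sum_smul_const_tvs` (`t ↦ ∑ i, c i t • v i`) [folklore].

Motivation as in `TVSDerivSlope.lean` (HodgeCM PerL cell `pub-hodgecm`, LEAN-IN-TREE rule: the cell's
one-parameter calculus for vectors in Weil's Schwartz–Bruhat topology — Leibniz rule for the Weil action,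
conjugation transport, finite-dimensional orbit principle — is the content of §§2–4 for `π = ω`); nothing here
refers to that application.

## References

* N. Bourbaki, *Fonctions d'une variable réelle*, Ch. I § 1, n° 2 Prop. 1, n° 5 Prop. 5 [Bourbaki1949FVR]
  (held text `book:bourbaki1949-fonctions-d-une-variable-reelle-theorie-elementaire`, pp. p0013, p0018).
-/

set_option autoImplicit false

noncomputable section

open Filter Set
open _root_.Topology

namespace Literature.Analysis.Calculus.TVSDeriv

variable {𝕜 : Type*} [NontriviallyNormedField 𝕜]
variable {F : Type*} [AddCommGroup F] [Module 𝕜 F] [TopologicalSpace F] [IsTopologicalAddGroup F]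
  [ContinuousSMul 𝕜 F]
variable {G : Type*} [AddCommGroup G] [Module 𝕜 G] [TopologicalSpace G] [IsTopologicalAddGroup G]
  [ContinuousSMul 𝕜 G]
variable {f f₁ g : 𝕜 → F} {f' g' : F} {x : 𝕜}

/-! ## §1 Local nature; constants, negatives, differences, sums; scalar function times a vector -/

omit [IsTopologicalAddGroup F] in
/-- **The derivative is a local notion**: a function eventually equal to `f` near `x` has the same derivative
at `x`. [folklore] -/
theorem _root_.HasDerivAt.congr_of_eventuallyEq_tvs (h : HasDerivAt f f' x) (h₁ : f₁ =ᶠ[𝓝 x] f) :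
    HasDerivAt f₁ f' x :=
  hasDerivAt_iff_hasFDerivAt.2 ((hasDerivAt_iff_hasFDerivAt.1 h).congr_of_eventuallyEq h₁)

omit [IsTopologicalAddGroup F] in
/-- Change of the derivative by an equal vector. [folklore] -/
theorem _root_.HasDerivAt.congr_deriv_tvs {f'' : F} (h : HasDerivAt f f' x) (h' : f' = f'') :
    HasDerivAt f f'' x :=
  h' ▸ h

/-- A constant curve has derivative `0`. [folklore] -/
theorem hasDerivAt_const_tvs (c : F) (x : 𝕜) : HasDerivAt (fun _ : 𝕜 ↦ c) (0 : F) x := by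
  rw [hasDerivAt_iff_tendsto_slope_tvs]
  have : slope (fun _ : 𝕜 ↦ c) x = fun _ ↦ (0 : F) := by
    ext y
    simp [slope_def_module]
  rw [this]
  exact tendsto_const_nhds

/-- `(-f)' = -f'`. [cite: Bourbaki1949FVR, I §1 no.2 Prop. 1] -/
theorem _root_.HasDerivAt.neg_tvs (hf : HasDerivAt f f' x) : HasDerivAt (fun t ↦ -f t) (-f') x := by
  simpa using hf.linearMap_comp_tvs (-LinearMap.id : F →ₗ[𝕜] F) (continuous_neg)

/-- `(f - g)' = f' - g'`. [cite: Bourbaki1949FVR, I §1 no.2 Prop. 1] -/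
theorem _root_.HasDerivAt.sub_tvs (hf : HasDerivAt f f' x) (hg : HasDerivAt g g' x) :
    HasDerivAt (fun t ↦ f t - g t) (f' - g') x := by
  simpa [sub_eq_add_neg] using hf.add_tvs hg.neg_tvs

/-- `(∑ᵢ fᵢ)' = ∑ᵢ fᵢ'` over a finite set. [cite: Bourbaki1949FVR, I §1 no.2 Prop. 1] -/
theorem _root_.HasDerivAt.sum_tvs {ι : Type*} (s : Finset ι) {A : ι → 𝕜 → F} {A' : ι → F}
    (h : ∀ i ∈ s, HasDerivAt (A i) (A' i) x) :
    HasDerivAt (fun t ↦ ∑ i ∈ s, A i t) (∑ i ∈ s, A' i) x := by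
  classical
  induction s using Finset.induction_on with
  | empty => simpa using hasDerivAt_const_tvs (0 : F) x
  | insert a s ha ih =>
    simp only [Finset.sum_insert ha]
    exact (h a (Finset.mem_insert_self a s)).add_tvs
      (ih fun i hi ↦ h i (Finset.mem_insert_of_mem hi))

/-- **A differentiable scalar function times a fixed vector**: `(c • v)' = c' • v`, the scalars `c t` taken in
a normed algebra `𝕜'` over `𝕜` acting on `F` (e.g. `𝕜 = ℝ`, `𝕜' = ℂ`). [folklore] -/
theorem _root_.HasDerivAt.smul_const_tvs {𝕜' : Type*} [NormedField 𝕜'] [NormedAlgebra 𝕜 𝕜'] [Module 𝕜' F]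
    [IsScalarTower 𝕜 𝕜' F] [ContinuousSMul 𝕜' F] {c : 𝕜 → 𝕜'} {c' : 𝕜'} (hc : HasDerivAt c c' x) (v : F) :
    HasDerivAt (fun t ↦ c t • v) (c' • v) x := by
  rw [hasDerivAt_iff_tendsto_slope_tvs]
  have hs : slope (fun t ↦ c t • v) x = fun t ↦ slope c x t • v := by
    ext t
    rw [slope_def_module, slope_def_module, ← sub_smul, smul_assoc]
  rw [hs]
  exact ((hasDerivAt_iff_tendsto_slope.1 hc).smul_const v)

/-! ## §2 The chain rule (Bourbaki FVR I §1 n°5 Prop. 5) -/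

/-- **Carathéodory form of the derivative**: `f y - f y₀ = (y - y₀) • ψ y` with `ψ` continuous at `y₀` and
`ψ y₀ = f'` (`ψ` = the slope function patched at `y₀`). [folklore] -/
theorem _root_.HasDerivAt.exists_slope_fun_tvs {y₀ : 𝕜} (h : HasDerivAt f f' y₀) :
    ∃ ψ : 𝕜 → F, ContinuousAt ψ y₀ ∧ ψ y₀ = f' ∧ ∀ y, f y - f y₀ = (y - y₀) • ψ y := by
  classical
  refine ⟨Function.update (slope f y₀) y₀ f', ?_, Function.update_self .., fun y ↦ ?_⟩
  · -- continuity at `y₀`: the slope tends to `f'` on the punctured neighbourhood, and the value is `f'`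
    refine continuousWithinAt_compl_self.1 ?_
    rw [ContinuousWithinAt, Function.update_self]
    refine ((hasDerivAt_iff_tendsto_slope_tvs.1 h).congr' ?_)
    filter_upwards [self_mem_nhdsWithin] with y hy
    rw [Function.update_of_ne hy]
  · by_cases hy : y = y₀
    · subst hy; simp
    · rw [Function.update_of_ne hy, slope_def_module, smul_smul, mul_inv_cancel₀ (sub_ne_zero.2 hy),
        one_smul]

/-- **Chain rule** (Bourbaki FVR I §1 n°5 Prop. 5): if `f` has derivative `f'` at `u x` and `u : 𝕜 → 𝕜` has
derivative `u'` at `x`, then `f ∘ u` has derivative `u' • f'` at `x`. [cite: Bourbaki1949FVR, I §1 no.5 Prop. 5] -/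
theorem _root_.HasDerivAt.scomp_tvs {u : 𝕜 → 𝕜} {u' : 𝕜} (hf : HasDerivAt f f' (u x))
    (hu : HasDerivAt u u' x) : HasDerivAt (fun t ↦ f (u t)) (u' • f') x := by
  obtain ⟨ψ, hψ, hψ₀, hfψ⟩ := hf.exists_slope_fun_tvs
  rw [hasDerivAt_iff_tendsto_slope_tvs]
  have hs : slope (fun t ↦ f (u t)) x = fun t ↦ slope u x t • ψ (u t) := by
    ext t
    rw [slope_def_module, slope_def_field, hfψ (u t), smul_smul, div_eq_inv_mul]
  rw [hs, ← hψ₀]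
  have hux : Tendsto (fun t ↦ ψ (u t)) (𝓝[≠] x) (𝓝 (ψ (u x))) :=
    (hψ.tendsto.comp hu.continuousAt.tendsto).mono_left nhdsWithin_le_nhds
  exact (hasDerivAt_iff_tendsto_slope.1 hu).smul hux

/-- Shift of the parameter: `t ↦ f (a + t)`. [folklore] -/
theorem _root_.HasDerivAt.comp_const_add_tvs (a : 𝕜) (hf : HasDerivAt f f' (a + x)) :
    HasDerivAt (fun t ↦ f (a + t)) f' x := by
  simpa using hf.scomp_tvs ((hasDerivAt_id x).const_add a)

/-- Shift of the parameter: `t ↦ f (t + a)`. [folklore] -/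
theorem _root_.HasDerivAt.comp_add_const_tvs (a : 𝕜) (hf : HasDerivAt f f' (x + a)) :
    HasDerivAt (fun t ↦ f (t + a)) f' x := by
  have h := HasDerivAt.scomp_tvs (u := fun t ↦ t + a) hf ((hasDerivAt_id x).add_const a)
  simpa using h

/-- Rescaling of the parameter: `t ↦ f (a * t)` has derivative `a • f'`. [folklore] -/
theorem _root_.HasDerivAt.comp_const_mul_tvs (a : 𝕜) (hf : HasDerivAt f f' (a * x)) :
    HasDerivAt (fun t ↦ f (a * t)) (a • f') x := by
  simpa using hf.scomp_tvs ((hasDerivAt_id x).const_mul a)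

/-! ## §3 Leibniz rule along a jointly continuous family of linear maps; representations -/

/-- **Leibniz rule along a jointly continuous family of linear maps.** `A : X → (F →ₗ G)` with
`(p, v) ↦ A p v` jointly continuous, `g : 𝕜 → X` continuous at `x`, `f` with derivative `f'` at `x`, and the
curve of the FIXED vector `t ↦ A (g t) (f x)` with derivative `δ` at `x`. Then `t ↦ A (g t) (f t)` has
derivative `A (g x) f' + δ` at `x`. (Joint continuity controls `A (g t) (slope f)`; no equicontinuity or local
boundedness is needed beyond it.) [folklore] -/
theorem _root_.HasDerivAt.linearFamily_tvs {X : Type*} [TopologicalSpace X] (A : X → F →ₗ[𝕜] G)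
    (hA : Continuous fun p : X × F ↦ A p.1 p.2) {g : 𝕜 → X} (hg : ContinuousAt g x)
    (hf : HasDerivAt f f' x) {δ : G} (hδ : HasDerivAt (fun t ↦ A (g t) (f x)) δ x) :
    HasDerivAt (fun t ↦ A (g t) (f t)) (A (g x) f' + δ) x := by
  rw [hasDerivAt_iff_tendsto_slope_tvs] at hf hδ ⊢
  have hs : slope (fun t ↦ A (g t) (f t)) x =
      fun t ↦ A (g t) (slope f x t) + slope (fun t ↦ A (g t) (f x)) x t := by
    ext t
    simp only [slope_def_module, map_smul, map_sub, ← smul_add]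
    congr 1
    abel
  rw [hs]
  refine Tendsto.add ?_ hδ
  have hj : Tendsto (fun t ↦ (g t, slope f x t)) (𝓝[≠] x) (𝓝 (g x, f')) :=
    (hg.tendsto.mono_left nhdsWithin_le_nhds).prodMk_nhds hf
  exact (hA.tendsto (g x, f')).comp hj

section Representation

variable {M : Type*} [Monoid M] [TopologicalSpace M] (π : M →* Module.End 𝕜 F)
  (hπ : Continuous fun p : M × F ↦ π p.1 p.2)
include hπ

omit [IsTopologicalAddGroup F] [ContinuousSMul 𝕜 F] in
/-- Each operator of a jointly continuous representation is continuous. [folklore] -/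
theorem continuous_repr_apply (m : M) : Continuous fun v : F ↦ π m v :=
  hπ.comp (Continuous.prodMk_right m)

/-- **Products of one-parameter families.** `e₁` continuous at `x`, `t ↦ π (e₂ t) v` with derivative `X₂` at
`x`, `t ↦ π (e₁ t) (π (e₂ x) v)` with derivative `X₁` at `x`; then `t ↦ π (e₁ t * e₂ t) v` has derivative
`π (e₁ x) X₂ + X₁` at `x`. [folklore] -/
theorem hasDerivAt_repr_mul_tvs {e₁ e₂ : 𝕜 → M} (he₁ : ContinuousAt e₁ x) (v : F) {X₁ X₂ : F}
    (h₂ : HasDerivAt (fun t ↦ π (e₂ t) v) X₂ x) (h₁ : HasDerivAt (fun t ↦ π (e₁ t) (π (e₂ x) v)) X₁ x) :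
    HasDerivAt (fun t ↦ π (e₁ t * e₂ t) v) (π (e₁ x) X₂ + X₁) x := by
  have h := h₂.linearFamily_tvs (fun m ↦ (π m : F →ₗ[𝕜] F)) hπ he₁ h₁
  simpa [map_mul, Module.End.mul_apply] using h

/-- **Generator additivity at the identity**: if `e₁ x = e₂ x = 1` and `t ↦ π (eᵢ t) v` has derivative `Xᵢ`
at `x`, then `t ↦ π (e₁ t * e₂ t) v` has derivative `X₁ + X₂` at `x` — no Baker–Campbell–Hausdorff formula,
no commutator estimate. [folklore] -/
theorem hasDerivAt_repr_mul_of_eq_one_tvs {e₁ e₂ : 𝕜 → M} (he₁ : ContinuousAt e₁ x) (h₁1 : e₁ x = 1)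
    (h₂1 : e₂ x = 1) (v : F) {X₁ X₂ : F} (h₁ : HasDerivAt (fun t ↦ π (e₁ t) v) X₁ x)
    (h₂ : HasDerivAt (fun t ↦ π (e₂ t) v) X₂ x) :
    HasDerivAt (fun t ↦ π (e₁ t * e₂ t) v) (X₁ + X₂) x := by
  have h₁' : HasDerivAt (fun t ↦ π (e₁ t) (π (e₂ x) v)) X₁ x := by simpa [h₂1] using h₁
  have h := hasDerivAt_repr_mul_tvs π hπ he₁ v h₂ h₁'
  simpa [h₁1, add_comm] using h

omit hπ in
/-- **Conjugate families** in a group: `t ↦ π (w * e t * w⁻¹) v` has derivative `π w X`, where `X` is the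
derivative of `t ↦ π (e t) (π w⁻¹ v)`. [folklore] -/
theorem hasDerivAt_repr_conj_tvs {H : Type*} [Group H] [TopologicalSpace H] (ρ : H →* Module.End 𝕜 F)
    (hρ : Continuous fun p : H × F ↦ ρ p.1 p.2) (w : H) {e : 𝕜 → H} (v : F) {X : F}
    (h : HasDerivAt (fun t ↦ ρ (e t) (ρ w⁻¹ v)) X x) :
    HasDerivAt (fun t ↦ ρ (w * e t * w⁻¹) v) (ρ w X) x := by
  have hc : Continuous fun u : F ↦ ρ w u := hρ.comp (Continuous.prodMk_right w)
  have h' := h.linearMap_comp_tvs (ρ w : F →ₗ[𝕜] F) hc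
  simpa [map_mul, Module.End.mul_apply] using h'

end Representation

/-! ## §4 Curves through a finite-dimensional space -/

/-- **Curves through a finite-dimensional space.** `V` a finite-dimensional Hausdorff topological vector space
over a complete `𝕜`, `ι : V →ₗ[𝕜] F` ANY linear map (automatically continuous,
`LinearMap.continuous_of_finiteDimensional`), `c` with derivative `c'` at `x`. Then `ι ∘ c` has derivative
`ι c'` at `x` — in whatever topology `F` carries. [folklore] -/
theorem _root_.HasDerivAt.linearMap_comp_of_finiteDimensional_tvs [CompleteSpace 𝕜] {V : Type*}
    [AddCommGroup V] [Module 𝕜 V] [TopologicalSpace V] [IsTopologicalAddGroup V] [ContinuousSMul 𝕜 V]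
    [T2Space V] [FiniteDimensional 𝕜 V] (ι : V →ₗ[𝕜] F) {c : 𝕜 → V} {c' : V} (hc : HasDerivAt c c' x) :
    HasDerivAt (fun t ↦ ι (c t)) (ι c') x :=
  hc.linearMap_comp_tvs ι ι.continuous_of_finiteDimensional

/-- **Finite linear combinations with differentiable coefficients**: `t ↦ ∑ i ∈ s, c i t • v i` has derivative
`∑ i ∈ s, c' i • v i` (coefficients in a normed algebra `𝕜'` over `𝕜` acting on `F`). [folklore] -/
theorem hasDerivAt_sum_smul_const_tvs {𝕜' : Type*} [NormedField 𝕜'] [NormedAlgebra 𝕜 𝕜'] [Module 𝕜' F]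
    [IsScalarTower 𝕜 𝕜' F] [ContinuousSMul 𝕜' F] {ι : Type*} (s : Finset ι) {c : ι → 𝕜 → 𝕜'}
    {c' : ι → 𝕜'} (hc : ∀ i ∈ s, HasDerivAt (c i) (c' i) x) (v : ι → F) :
    HasDerivAt (fun t ↦ ∑ i ∈ s, c i t • v i) (∑ i ∈ s, c' i • v i) x :=
  HasDerivAt.sum_tvs s fun i hi ↦ (hc i hi).smul_const_tvs (v i)

end Literature.Analysis.Calculus.TVSDeriv

end
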